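import Literature.AlgebraicGeometry.Limits.ClosedSubsetStageDescent
import Literature.AlgebraicGeometry.Motives.FiberBaseChange
import Literature.AlgebraicGeometry.Motives.BaseChangeProofs
import Literature.AlgebraicGeometry.HodgeTheory.AlgebraicityLocus
import HarnessLib

/-!
# Spreading a closed subset of the fibre over a generic complex point

The "spreading out" step in the proof that the algebraicity locus of a flat section is defined
over the field of definition of the family (Charles–Schnell, *Notes on absolute Hodge classes*,
§11.3.3, Remark after Cor. 11.3.16: "the subvariety `Z ⊆ 𝒳₀ ×_B T` ... by a spreading-out
argument"; Voisin, *Hodge loci and absolute Hodge classes*, proof of Thm. 0.6 (2)), in the following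
elementary form. Let `f₀ : 𝒳₀ ⟶ S₀` be a morphism of `k`-schemes with `S₀ = Spec R` affine and
integral, `σ : k →+* ℂ`, and `s` a complex point of `S₀ ⊗_σ ℂ` lying over the generic point of
`S₀`, i.e. an injection `φ : R ↪ ℂ`. The fibre of `f₀ ⊗ ℂ` over `s` is `𝒳₀ ×_R Spec ℂ`, the limit
of the schemes `𝒳₀ ×_R Spec R[t]` over the finitely generated `R`-subalgebras `R[t] ⊆ ℂ`
(`SubalgApprox`, EGA IV₃ 8.2); a closed subset `V` of the fibre with quasi-compact complement is
the preimage of a closed subset `Z` of some stage (`exists_spread_isClosed_over_generic`). The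
stage `T₀ := Spec R[t]` is an integral affine `k`-scheme, dominant and of finite type over `S₀`,
the tautological point `R[t] ⊆ ℂ` is a complex point `t` of `T₀ ⊗_σ ℂ` over the generic point of
`T₀` mapping to `s`, and the fibre of `𝒲₀ := 𝒳₀ ×_{S₀} T₀ → T₀` (complexified) over `t` is
identified with the fibre over `s`, the slice of `Z` corresponding to `V`
(`exists_spread_isClosed_fiberOver_generic`).

Also: base change along `σ` preserves cartesian squares
(`isPullback_baseChangeHom_map_of_isPullback`), and the fibres of the two families in a
cartesian square correspond (`exists_fiberOver_iso_of_isPullback`; Görtz–Wedhorn I, Prop. 4.16,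
"transitivity of fibre products").
-/

noncomputable section

open CategoryTheory CategoryTheory.Limits AlgebraicGeometry TopologicalSpace Opposite
open MonoidalCategory

set_option backward.isDefEq.respectTransparency false

namespace Literature.AlgebraicGeometry.HodgeTheory

open Literature.AlgebraicGeometry.Motives Literature.AlgebraicGeometry.Limits

/-! ### Base change preserves cartesian squares -/

section Square

variable {k L : Type} [Field k] [Field L] (σ : k →+* L)

/-- **Base change along a field homomorphism preserves cartesian squares**: if
`(q₀, g₀; f₀, h₀)` is a cartesian square of `k`-schemes (on underlying schemes), so is its base
change along `σ : k →+* L` (pasting of the base-change squares `X ⊗ L = X ×_Y (Y ⊗ L)`,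
Görtz–Wedhorn I, Prop. 4.16). [cite: GortzWedhorn2020, Prop. 4.16 and §(4.7)] -/
theorem isPullback_baseChangeHom_map_of_isPullback {𝒲₀ 𝒳₀ T₀ S₀ : SchemeOver k}
    {q₀ : 𝒲₀ ⟶ 𝒳₀} {g₀ : 𝒲₀ ⟶ T₀} {f₀ : 𝒳₀ ⟶ S₀} {h₀ : T₀ ⟶ S₀}
    (H : IsPullback q₀.left g₀.left f₀.left h₀.left) :
    IsPullback ((baseChangeHom σ).map q₀).left ((baseChangeHom σ).map g₀).left
      ((baseChangeHom σ).map f₀).left ((baseChangeHom σ).map h₀).left := by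
  letI := σ.toAlgebra
  have Hg : IsPullback (baseChangeHomFst σ 𝒲₀) ((baseChangeHom σ).map g₀).left g₀.left
      (baseChangeHomFst σ T₀) := (isPullback_baseChange_map_left L g₀).flip
  have Hf : IsPullback (baseChangeHomFst σ 𝒳₀) ((baseChangeHom σ).map f₀).left f₀.left
      (baseChangeHomFst σ S₀) := (isPullback_baseChange_map_left L f₀).flip
  have outer : IsPullback (((baseChangeHom σ).map q₀).left ≫ baseChangeHomFst σ 𝒳₀)
      ((baseChangeHom σ).map g₀).left f₀.left
      (((baseChangeHom σ).map h₀).left ≫ baseChangeHomFst σ S₀) := by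
    rw [baseChangeHom_map_left_comp_fst, baseChangeHom_map_left_comp_fst]
    exact Hg.paste_horiz H
  refine outer.of_right ?_ Hf
  have hq : ((baseChangeHom σ).map q₀).left ≫ ((baseChangeHom σ).map f₀).left =
      ((baseChangeHom σ).map g₀).left ≫ ((baseChangeHom σ).map h₀).left := by
    have hsq : q₀ ≫ f₀ = g₀ ≫ h₀ := by ext : 1; exact H.w
    rw [← Over.comp_left, ← Functor.map_comp, hsq, Functor.map_comp, Over.comp_left]
  exact hq

/-- The same, as a cartesian square in `L`-schemes (the forgetful functor `Over (Spec L) ⥤ Scheme`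
reflects pullbacks). [cite: GortzWedhorn2020, Prop. 4.16 and §(4.7)] -/
theorem isPullback_baseChangeHom_map_of_isPullback' {𝒲₀ 𝒳₀ T₀ S₀ : SchemeOver k}
    {q₀ : 𝒲₀ ⟶ 𝒳₀} {g₀ : 𝒲₀ ⟶ T₀} {f₀ : 𝒳₀ ⟶ S₀} {h₀ : T₀ ⟶ S₀}
    (H : IsPullback q₀.left g₀.left f₀.left h₀.left) :
    IsPullback ((baseChangeHom σ).map q₀) ((baseChangeHom σ).map g₀)
      ((baseChangeHom σ).map f₀) ((baseChangeHom σ).map h₀) := by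
  have hsq : q₀ ≫ f₀ = g₀ ≫ h₀ := by ext : 1; exact H.w
  refine IsPullback.of_map (Over.forget _) ?_ (isPullback_baseChangeHom_map_of_isPullback σ H)
  rw [← Functor.map_comp, hsq, Functor.map_comp]

/-- The fibre square `𝒳_t ⟶ 𝒳`, `𝒳_t ⟶ Spec k`, `f`, `t` is cartesian in `k`-schemes
(Hartshorne II.3, fibre of a morphism). [folklore] -/
private theorem isPullback_fiberι_fiberOverToSpec {𝒳 S : SchemeOver k} (f : 𝒳 ⟶ S)
    (t : AlgPoints S k) : IsPullback (fiberι f t) (fiberOverToSpec f t) f t :=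
  IsPullback.of_map (Over.forget _) (fiberι_comp f t) (IsPullback.of_hasPullback f.left t.left)

/-- **Fibres in a cartesian square correspond**: for a cartesian square `(q, g; f, h)` of
`k`-schemes and a rational point `y` of the base `T` of `g`, the fibre of `g` over `y` is
isomorphic, over `k` and compatibly with the inclusions `q`, to the fibre of `f` over `h(y)`
(transitivity of fibre products). [cite: GortzWedhorn2020, Prop. 4.16 and §(4.7)] -/
theorem exists_fiberOver_iso_of_isPullback {𝒲 𝒳 T S : SchemeOver k} {q : 𝒲 ⟶ 𝒳} {g : 𝒲 ⟶ T}
    {f : 𝒳 ⟶ S} {h : T ⟶ S} (H : IsPullback q g f h) (y : AlgPoints T k) :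
    ∃ e : fiberOver g y ≅ fiberOver f (AlgPoints.map h y),
      e.hom ≫ fiberι f (AlgPoints.map h y) = fiberι g y ≫ q :=
  ⟨((isPullback_fiberι_fiberOverToSpec g y).paste_horiz H).isoIsPullback _ _
      (isPullback_fiberι_fiberOverToSpec f (AlgPoints.map h y)),
    IsPullback.isoIsPullback_hom_fst _ _ _ _⟩

end Square

/-! ### The spread -/

section Spread

variable {k : Type} [Field k] (σ : k →+* ℂ) {𝒳₀ S₀ : SchemeOver k} (f₀ : 𝒳₀ ⟶ S₀)

/-- **Spread of a closed subset of the fibre over a complex point lying over the generic point of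
an affine base.** Let `f₀ : 𝒳₀ ⟶ S₀` be a morphism of `k`-schemes with `S₀` affine and integral,
`σ : k →+* ℂ`, `s` a complex point of `S₀ ⊗_σ ℂ` lying over the generic point of `S₀`, and
`V ⊆ (f₀ ⊗ ℂ)⁻¹(s)` Zariski-closed with quasi-compact complement. Then there are: an integral affine
`k`-scheme `T₀` with a DOMINANT morphism `h₀ : T₀ ⟶ S₀` locally of finite type, the base-changed
family `g₀ : 𝒲₀ = 𝒳₀ ×_{S₀} T₀ ⟶ T₀` (cartesian square `(q₀, g₀; f₀, h₀)`), a closed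
`Z ⊆ 𝒲₀`, and a complex point `t` of `T₀ ⊗_σ ℂ` over the GENERIC point of `T₀` with `h(t) = s`,
together with an isomorphism `e` of the fibre of `g₀ ⊗ ℂ` over `t` with the fibre of `f₀ ⊗ ℂ` over
`s`, compatible with the inclusions into `𝒳₀ ⊗ ℂ`, carrying the slice of `Z` onto `V`.
Construction: `S₀ ≅ Spec R`, the fibre over `s` is `𝒳₀ ×_R Spec ℂ` for the point `φ : R → ℂ`
(injective: `s` is generic), `V` descends to a stage `𝒳₀ ×_R Spec R[t]`
(`SubalgApprox.exists_spread_isClosed_over_generic`), `T₀ := Spec R[t]`, and `t` is the tautological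
point `R[t] ⊆ ℂ`. [cite: CharlesSchnell2014Notes, Remark after Cor. 11.3.16 and Lemma 11.3.14]
[cite: GortzWedhorn2020, (10.13), Thm. 10.57 and Prop. 4.16] -/
theorem exists_spread_isClosed_fiberOver_generic [IsAffine S₀.left] [IsIntegral S₀.left]
    (s : ComplexPoints ((baseChangeHom σ).obj S₀))
    (hs : baseChangeHomFst σ S₀ s.pt = genericPoint S₀.left)
    {V : Set (fiberOver ((baseChangeHom σ).map f₀) s).left} (hV : IsClosed V) (hVc : IsCompact Vᶜ) :
    ∃ (T₀ 𝒲₀ : SchemeOver k) (_ : IsAffine T₀.left) (_ : IsIntegral T₀.left) (h₀ : T₀ ⟶ S₀)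
      (_ : LocallyOfFiniteType h₀.left) (_ : IsDominant h₀.left)
      (g₀ : 𝒲₀ ⟶ T₀) (q₀ : 𝒲₀ ⟶ 𝒳₀) (Z : Set 𝒲₀.left)
      (t : ComplexPoints ((baseChangeHom σ).obj T₀))
      (e : fiberOver ((baseChangeHom σ).map g₀) t ≅ fiberOver ((baseChangeHom σ).map f₀) s),
      IsPullback q₀.left g₀.left f₀.left h₀.left ∧ IsClosed Z ∧
      AlgPoints.map ((baseChangeHom σ).map h₀) t = s ∧
      baseChangeHomFst σ T₀ t.pt = genericPoint T₀.left ∧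
      e.hom ≫ fiberι ((baseChangeHom σ).map f₀) s =
        fiberι ((baseChangeHom σ).map g₀) t ≫ (baseChangeHom σ).map q₀ ∧
      e.hom.left ⁻¹' V =
        ((fiberι ((baseChangeHom σ).map g₀) t).left ≫ baseChangeHomFst σ 𝒲₀) ⁻¹' Z := by
  classical
  letI := σ.toAlgebra
  -- ### `S₀ ≅ Spec R` and the point `φ : R → ℂ`
  set R : CommRingCat := Γ(S₀.left, ⊤) with hR
  let ι : S₀.left ≅ Spec R := S₀.left.isoSpec
  let prS := baseChangeHomFst σ S₀
  let s₀ : Spec (.of ℂ) ⟶ Spec R := s.left ≫ prS ≫ ι.hom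
  let φ : R ⟶ CommRingCat.of ℂ := Spec.preimage s₀
  have hφ : Spec.map φ = s₀ := Spec.map_preimage s₀
  letI algR : Algebra R ℂ := φ.hom.toAlgebra
  have halg : CommRingCat.ofHom (algebraMap R ℂ) = φ := rfl
  -- `φ` is injective: `s₀` hits the generic point of the integral `Spec R`
  haveI : IsDomain R := by
    haveI : Nonempty (↑(⊤ : S₀.left.Opens) : Set S₀.left) :=
      ⟨⟨genericPoint S₀.left, trivial⟩⟩
    exact inferInstanceAs (IsDomain Γ(S₀.left, ⊤))
  have hs₀pt : s₀ (IsLocalRing.closedPoint ℂ) = genericPoint ↥(Spec R) := by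
    change ι.hom (prS (s.left (IsLocalRing.closedPoint ℂ))) = _
    have h1 : s.left (IsLocalRing.closedPoint ℂ) = s.pt := rfl
    rw [h1, hs]
    exact genericPoint_eq_of_isOpenImmersion ι.hom ▸ rfl
  have hφinj : Function.Injective (algebraMap R ℂ) := by
    change Function.Injective φ.hom
    rw [RingHom.injective_iff_ker_eq_bot]
    have h1 : (Spec.map φ) (IsLocalRing.closedPoint ℂ) = genericPoint ↥(Spec R) := by rw [hφ, hs₀pt]
    rw [genericPoint_eq_bot_of_affine] at h1
    have h2 := congrArg PrimeSpectrum.asIdeal h1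
    change Ideal.comap φ.hom (IsLocalRing.closedPoint ℂ).asIdeal = ⊥ at h2
    have h3 : (IsLocalRing.closedPoint ℂ).asIdeal = ⊥ := Ideal.eq_bot_of_prime _
    rw [h3, ← RingHom.ker_eq_comap_bot] at h2
    exact h2
  -- ### the family over `Spec R` and the fibre over `s` as `𝒳₀ ×_R Spec ℂ`
  let P : SchemeOver R := Over.mk (f₀.left ≫ ι.hom)
  have hPleft : (P ⊗ specOver R ℂ).left = pullback P.hom (specOver R ℂ).hom := rfl
  -- square A: the fibre over `s` is the pullback of `f₀` along `Spec ℂ → S₀`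
  have A : IsPullback ((fiberι ((baseChangeHom σ).map f₀) s).left ≫ baseChangeHomFst σ 𝒳₀)
      (fiberOverToSpec ((baseChangeHom σ).map f₀) s).left (f₀.left ≫ ι.hom) (specOver R ℂ).hom := by
    have A₀ : IsPullback ((fiberι ((baseChangeHom σ).map f₀) s).left ≫ baseChangeHomFst σ 𝒳₀)
        (fiberOverToSpec ((baseChangeHom σ).map f₀) s).left f₀.left (s.left ≫ prS) :=
      (IsPullback.of_hasPullback ((baseChangeHom σ).map f₀).left s.left).paste_horiz
        (isPullback_baseChange_map_left ℂ f₀).flip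
    have A₁ : IsPullback (𝟙 𝒳₀.left) f₀.left (f₀.left ≫ ι.hom) ι.hom :=
      IsPullback.of_horiz_isIso ⟨by rw [Category.id_comp]⟩
    have A₂ : IsPullback ((fiberι ((baseChangeHom σ).map f₀) s).left ≫ baseChangeHomFst σ 𝒳₀)
        (fiberOverToSpec ((baseChangeHom σ).map f₀) s).left (f₀.left ≫ ι.hom)
        ((s.left ≫ prS) ≫ ι.hom) := by
      simpa only [Category.comp_id] using A₀.paste_horiz A₁
    have hbot : (s.left ≫ prS) ≫ ι.hom = (specOver R ℂ).hom := by
      change s₀ = Spec.map (CommRingCat.ofHom (algebraMap R ℂ))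
      rw [halg, hφ]
    rwa [hbot] at A₂
  have B : IsPullback (pullback.fst P.hom (specOver R ℂ).hom) (pullback.snd P.hom (specOver R ℂ).hom)
      (f₀.left ≫ ι.hom) (specOver R ℂ).hom := IsPullback.of_hasPullback _ _
  let e₁ : (fiberOver ((baseChangeHom σ).map f₀) s).left ≅ (P ⊗ specOver R ℂ).left :=
    A.isoIsPullback _ _ B
  have he₁fst : e₁.hom ≫ pullback.fst P.hom (specOver R ℂ).hom =
      (fiberι ((baseChangeHom σ).map f₀) s).left ≫ baseChangeHomFst σ 𝒳₀ :=
    A.isoIsPullback_hom_fst _ _ B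
  have he₁snd : e₁.hom ≫ pullback.snd P.hom (specOver R ℂ).hom =
      (fiberOverToSpec ((baseChangeHom σ).map f₀) s).left :=
    A.isoIsPullback_hom_snd _ _ B
  -- the closed subset transported to `𝒳₀ ×_R Spec ℂ`
  let V' : Set ↥(P ⊗ specOver R ℂ).left := e₁.inv ⁻¹' V
  have hV' : IsClosed V' := hV.preimage e₁.inv.continuous
  have hV'c : IsCompact V'ᶜ := by
    have : V'ᶜ = e₁.hom '' Vᶜ := by
      ext x
      constructor
      · intro hx
        refine ⟨e₁.inv x, hx, ?_⟩
        change (e₁.inv ≫ e₁.hom) x = x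
        rw [e₁.inv_hom_id]; rfl
      · rintro ⟨y, hy, rfl⟩
        change e₁.inv (e₁.hom y) ∉ V
        change (e₁.hom ≫ e₁.inv) y ∉ V
        rw [e₁.hom_inv_id]; exact hy
    rw [this]
    exact hVc.image e₁.hom.continuous
  -- ### the stage
  obtain ⟨tt, Z, hZ, hVZ, hft, hint, hgen, hsq⟩ :=
    SubalgApprox.exists_spread_isClosed_over_generic (K := R) (L := ℂ) (∅ : Finset ℂ) P hV' hV'c
  let A' := SubalgApprox.sub (↑R) ℂ tt.1
  let stage : SchemeOver R := (SubalgApprox.baseDiagram (↑R) ℂ (∅ : Finset ℂ)).obj (op tt)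
  have hstage : stage = specOver R A' := rfl
  let leg : specOver R ℂ ⟶ stage := (SubalgApprox.baseCone (↑R) ℂ (∅ : Finset ℂ)).π.app (op tt)
  let πt := (SubalgApprox.prodCone (↑R) ℂ (∅ : Finset ℂ) P).π.app (op tt)
  -- ### the `k`-schemes `T₀`, `𝒲₀` and the square
  let T₀ : SchemeOver k := Over.mk (stage.hom ≫ ι.inv ≫ S₀.hom)
  let h₀ : T₀ ⟶ S₀ := Over.homMk (stage.hom ≫ ι.inv) rfl
  let 𝒲₀ : SchemeOver k := Over.mk (pullback.fst P.hom stage.hom ≫ 𝒳₀.hom)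
  have hgw : pullback.snd P.hom stage.hom ≫ T₀.hom = 𝒲₀.hom := by
    change pullback.snd P.hom stage.hom ≫ stage.hom ≫ ι.inv ≫ S₀.hom =
      pullback.fst P.hom stage.hom ≫ 𝒳₀.hom
    rw [← Over.w f₀, ← pullback.condition_assoc]
    change pullback.fst P.hom stage.hom ≫ (f₀.left ≫ ι.hom) ≫ ι.inv ≫ S₀.hom = _
    simp only [Category.assoc, Iso.hom_inv_id_assoc]
  let g₀ : 𝒲₀ ⟶ T₀ := Over.homMk (pullback.snd P.hom stage.hom) hgw
  let q₀ : 𝒲₀ ⟶ 𝒳₀ := Over.homMk (pullback.fst P.hom stage.hom) rfl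
  have Hsq : IsPullback q₀.left g₀.left f₀.left h₀.left := by
    have C₀ : IsPullback (pullback.fst P.hom stage.hom) (pullback.snd P.hom stage.hom)
        P.hom stage.hom := IsPullback.of_hasPullback _ _
    refine C₀.of_iso (Iso.refl _) (Iso.refl _) (Iso.refl _) ι.symm ?_ ?_ ?_ ?_
    · simp; rfl
    · simp; rfl
    · change (f₀.left ≫ ι.hom) ≫ ι.inv = 𝟙 _ ≫ f₀.left
      simp
    · change stage.hom ≫ ι.inv = 𝟙 _ ≫ (stage.hom ≫ ι.inv)
      simp
  -- ### the generic complex point `t` of `T₀ ⊗ ℂ`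
  have hlegw : leg.left ≫ T₀.hom = Spec.map (CommRingCat.ofHom (algebraMap k ℂ)) := by
    change leg.left ≫ stage.hom ≫ ι.inv ≫ S₀.hom = _
    rw [← Category.assoc, Over.w leg]
    have h1 : (specOver R ℂ).hom = s₀ := by
      change Spec.map (CommRingCat.ofHom (algebraMap R ℂ)) = s₀
      rw [halg, hφ]
    rw [h1]
    change (s.left ≫ prS ≫ ι.hom) ≫ ι.inv ≫ S₀.hom = _
    simp only [Category.assoc, Iso.hom_inv_id_assoc]
    rw [← Category.assoc]
    exact left_comp_baseChangeHomFst_comp_hom σ S₀ s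
  let tk : AlgPoints T₀ ℂ := AlgPoints.mk leg.left hlegw
  let t : ComplexPoints ((baseChangeHom σ).obj T₀) := AlgPoints.baseChangeEquiv σ T₀ tk
  have htfst : t.left ≫ baseChangeHomFst σ T₀ = leg.left :=
    AlgPoints.baseChangeEquiv_apply_left_comp_fst σ T₀ tk
  -- ### the fibre of `g₀ ⊗ ℂ` over `t` is `𝒳₀ ×_R Spec ℂ`
  have C : IsPullback ((fiberι ((baseChangeHom σ).map g₀) t).left ≫ baseChangeHomFst σ 𝒲₀)
      (fiberOverToSpec ((baseChangeHom σ).map g₀) t).left (pullback.snd P.hom stage.hom) leg.left := by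
    have C₀ : IsPullback ((fiberι ((baseChangeHom σ).map g₀) t).left ≫ baseChangeHomFst σ 𝒲₀)
        (fiberOverToSpec ((baseChangeHom σ).map g₀) t).left g₀.left (t.left ≫ baseChangeHomFst σ T₀) :=
      (IsPullback.of_hasPullback ((baseChangeHom σ).map g₀).left t.left).paste_horiz
        (isPullback_baseChange_map_left ℂ g₀).flip
    rw [htfst] at C₀
    exact C₀
  have D : IsPullback πt (pullback.snd P.hom (specOver R ℂ).hom) (pullback.snd P.hom stage.hom)
      leg.left := hsq
  let e₂ : (fiberOver ((baseChangeHom σ).map g₀) t).left ≅ (P ⊗ specOver R ℂ).left :=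
    C.isoIsPullback _ _ D
  have he₂fst : e₂.hom ≫ πt =
      (fiberι ((baseChangeHom σ).map g₀) t).left ≫ baseChangeHomFst σ 𝒲₀ :=
    C.isoIsPullback_hom_fst _ _ D
  have he₂snd : e₂.hom ≫ pullback.snd P.hom (specOver R ℂ).hom =
      (fiberOverToSpec ((baseChangeHom σ).map g₀) t).left :=
    C.isoIsPullback_hom_snd _ _ D
  let e : (fiberOver ((baseChangeHom σ).map g₀) t).left ≅
      (fiberOver ((baseChangeHom σ).map f₀) s).left := e₂ ≪≫ e₁.symm
  -- ### properties of `T₀` and `h₀`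
  haveI : IsAffine T₀.left := inferInstanceAs (IsAffine (Spec (CommRingCat.of A')))
  haveI hT₀int : IsIntegral T₀.left := hint
  haveI : Algebra.FiniteType R A' := hft
  haveI hlft : LocallyOfFiniteType stage.hom := by
    change LocallyOfFiniteType (Spec.map (CommRingCat.ofHom (algebraMap R A')))
    rw [HasRingHomProperty.Spec_iff (P := @LocallyOfFiniteType)]
    exact RingHom.finiteType_algebraMap.mpr inferInstance
  have hh₀l : h₀.left = stage.hom ≫ ι.inv := rfl
  haveI : LocallyOfFiniteType h₀.left :=
    inferInstanceAs (LocallyOfFiniteType (stage.hom ≫ ι.inv))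
  haveI hdomst : IsDominant stage.hom :=
    SubalgApprox.isDominant_baseDiagram_obj_hom (∅ : Finset ℂ) hφinj tt
  haveI : IsDominant ι.inv := ⟨ι.inv.surjective.denseRange⟩
  haveI : IsDominant h₀.left := by
    change IsDominant (stage.hom ≫ ι.inv)
    refine ⟨?_⟩
    rw [Scheme.Hom.comp_base, TopCat.coe_comp]
    exact ι.inv.denseRange.comp stage.hom.denseRange ι.inv.continuous
  -- `h(t) = s`
  have hts : AlgPoints.map ((baseChangeHom σ).map h₀) t = s := by
    apply (AlgPoints.baseChangeEquiv σ S₀).symm.injective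
    apply Over.OverMorphism.ext
    rw [AlgPoints.baseChangeEquiv_symm_apply_left, AlgPoints.baseChangeEquiv_symm_apply_left]
    have h1 : (specOver R ℂ).hom = s₀ := by
      change Spec.map (CommRingCat.ofHom (algebraMap R ℂ)) = s₀
      rw [halg, hφ]
    have h2 : leg.left ≫ stage.hom = s.left ≫ prS ≫ ι.hom := (Over.w leg).trans h1
    change (t.left ≫ ((baseChangeHom σ).map h₀).left) ≫ prS = s.left ≫ prS
    erw [Category.assoc, baseChangeHom_map_left_comp_fst, ← Category.assoc t.left, htfst]
    change leg.left ≫ stage.hom ≫ ι.inv = s.left ≫ prS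
    erw [← Category.assoc leg.left, h2, Category.assoc, Category.assoc, Iso.hom_inv_id]
    erw [Category.comp_id]
  -- compatibility of `e` with the inclusions into `𝒳₀ ⊗ ℂ`
  have hcomp : e.hom ≫ (fiberι ((baseChangeHom σ).map f₀) s).left =
      (fiberι ((baseChangeHom σ).map g₀) t).left ≫ ((baseChangeHom σ).map q₀).left := by
    have hfstPℂ : πt ≫ pullback.fst P.hom stage.hom = pullback.fst P.hom (specOver R ℂ).hom :=
      SubalgApprox.prodCone_π_app_fst (↑R) ℂ (∅ : Finset ℂ) P (op tt)
    apply pullback.hom_ext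
    · -- first projection to `𝒳₀`
      change (e₂.hom ≫ e₁.inv) ≫ (fiberι ((baseChangeHom σ).map f₀) s).left ≫ baseChangeHomFst σ 𝒳₀ =
        ((fiberι ((baseChangeHom σ).map g₀) t).left ≫ ((baseChangeHom σ).map q₀).left) ≫
          baseChangeHomFst σ 𝒳₀
      have k₂ : e₁.inv ≫ ((fiberι ((baseChangeHom σ).map f₀) s).left ≫ baseChangeHomFst σ 𝒳₀) =
          pullback.fst P.hom (specOver R ℂ).hom := by
        rw [Iso.inv_comp_eq]; exact he₁fst.symm
      rw [Category.assoc, Category.assoc, baseChangeHom_map_left_comp_fst]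
      erw [k₂, ← hfstPℂ, ← Category.assoc e₂.hom, he₂fst, Category.assoc]
    · -- structure maps to `Spec ℂ`
      change (e₂.hom ≫ e₁.inv) ≫ (fiberι ((baseChangeHom σ).map f₀) s).left ≫
          ((baseChangeHom σ).obj 𝒳₀).hom =
        ((fiberι ((baseChangeHom σ).map g₀) t).left ≫ ((baseChangeHom σ).map q₀).left) ≫
          ((baseChangeHom σ).obj 𝒳₀).hom
      have he₁snd' : e₁.hom ≫ pullback.snd P.hom (specOver R ℂ).hom =
          pullback.snd ((baseChangeHom σ).map f₀).left s.left := he₁snd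
      have he₂snd' : e₂.hom ≫ pullback.snd P.hom (specOver R ℂ).hom =
          pullback.snd ((baseChangeHom σ).map g₀).left t.left := he₂snd
      have k₁ : e₁.inv ≫ pullback.snd ((baseChangeHom σ).map f₀).left s.left =
          pullback.snd P.hom (specOver R ℂ).hom := by
        rw [Iso.inv_comp_eq]; exact he₁snd'.symm
      rw [Category.assoc, Category.assoc, Over.w ((baseChangeHom σ).map q₀),
        Over.w (fiberι ((baseChangeHom σ).map f₀) s), Over.w (fiberι ((baseChangeHom σ).map g₀) t),
        fiberOver_hom, fiberOver_hom]
      rw [← Category.assoc e₁.inv, k₁, ← Category.assoc e₂.hom, he₂snd']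
  -- `e` commutes with the structure maps, hence is an isomorphism over `Spec ℂ`
  have hw : e.hom ≫ (fiberOver ((baseChangeHom σ).map f₀) s).hom =
      (fiberOver ((baseChangeHom σ).map g₀) t).hom := by
    rw [← Over.w (fiberι ((baseChangeHom σ).map f₀) s), ← Category.assoc, hcomp, Category.assoc,
      Over.w ((baseChangeHom σ).map q₀), Over.w (fiberι ((baseChangeHom σ).map g₀) t)]
  let eO : fiberOver ((baseChangeHom σ).map g₀) t ≅ fiberOver ((baseChangeHom σ).map f₀) s :=
    Over.isoMk e hw
  refine ⟨T₀, 𝒲₀, inferInstance, hT₀int, h₀, inferInstance, inferInstance, g₀, q₀, Z, t, eO, Hsq, hZ,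
    hts, ?_, ?_, ?_⟩
  · -- `t` lies over the generic point of `T₀`
    rw [base_pt_baseChangeEquiv]
    exact SubalgApprox.baseCone_π_app_apply_eq_genericPoint (K := R) (L := ℂ) ∅ tt _
  · -- compatibility with the inclusions, in `SchemeOver ℂ`
    ext : 1
    exact hcomp
  · -- the slice of `Z` over `t` is `V`
    ext x
    refine Iff.trans ?_ ((Set.ext_iff.1 hVZ (e₂.hom x)).trans ?_)
    · exact Iff.rfl
    · rw [← he₂fst]; exact Iff.rfl

end Spread

end Literature.AlgebraicGeometry.HodgeTheory

end
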